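import Mathlib
import Summits.KontsevichZagierPeriods.Zeta5Search.ClusterValuation
import Summits.KontsevichZagierPeriods.Zeta5Search.DenomLaw.ThresholdModelBridge

/-!
# ζ(5) search — DENOM-LAW: the threshold model, PART III (bridge to the tree's `R_b`), part B: `classExp` = the sum of the census excesses

Cell `pub-zeta5`, track DENOM-LAW (K1 typing order item (1), «ThresholdModel port»): denom-engine-d2 g13's kernel-checked scratch module
`denom-law/engine-d2/g13/lean/LevelCensusBridge.lean` PART III (THRESHOLD-X5) filed VERBATIM in three parts (≤ 400 lines each; docstrings added
where the scratch file had none) by denom-prover-d1 g5.  Part B of 3.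
HONEST FRAMING: systematic search; MODEL/structure side — elementary integer arithmetic identifying the tree's `netExp`/`classSet`/`classExp`/`CentreIn` with the level census; nothing about ζ(5); no γ; no irrationality claim; records in print UNMOVED.
The mathematical header of PART III is the second module docstring of part A (`ThresholdModelBridge.lean`).
-/

namespace Summit.KontsevichZagierPeriods.Zeta5Search.DenomLaw.ThresholdModel.Rho

section TreeBridge

open Summit.KontsevichZagierPeriods.Zeta5Search.ClusterValuation (blockCount netExp classSet classExp CentreIn classPoleCount)
open Summit.KontsevichZagierPeriods.Zeta5Search.BigPrime (block)

section ClassExp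
variable {b : ℕ → ℤ} {p : ℕ} {m u : ℤ}

/-- **RE-INDEXING THE CLASS BY ITS LEVELS**: for any summand `g`, the sum over the tree's residue class `classSet b p x`
is the sum over the NUMERATOR LEVELS `ℓ ∈ [−1, 3m−1]` of the class offset `u` of `x`, along `ℓ ↦ q = t(ℓ,u) − 1`
(a `Finset.sum_bij`: into the class by `tOf_eq_tOf_zero_add`, injective by `tOf_inj`, onto by `exists_level_of_dvd`). -/
theorem sum_classSet_eq_sum_levels (h : LevelBox (p : ℤ) (R0b p m (b 0)) (rhob p m (b 0) (lowerB b))) (hm : 1 ≤ m)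
    (hc : (u - R0b (p : ℤ) m (b 0)) % 2 = 0) (hu1 : -(p : ℤ) < u) (hu2 : u ≤ p) {x : ℕ}
    (hx : (p : ℤ) ∣ (x : ℤ) + 1 - tOf p m (b 0) 0 u) (g : ℕ → ℤ) :
    (∑ s ∈ classSet b p x, g s) =
      ∑ ℓ ∈ (levels m).filter (fun ℓ => NumCov (p : ℤ) m (R0b p m (b 0)) ℓ u), g (tOf (p : ℤ) m (b 0) ℓ u - 1).toNat := by
  have hp1 : (1 : ℤ) ≤ p := h.one_le_p
  have hb0 := lbox_b0_nonneg h hm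
  have hu1' : -(p : ℤ) ≤ u := by linarith
  symm
  refine Finset.sum_bij (fun ℓ _ => (tOf (p : ℤ) m (b 0) ℓ u - 1).toNat) ?_ ?_ ?_ (fun ℓ _ => rfl)
  · -- lands in the class
    intro ℓ hℓ
    obtain ⟨-, hN⟩ := Finset.mem_filter.1 hℓ
    obtain ⟨h1, h2⟩ := (tOf_mem_num_iff hc).2 hN
    have e := tOf_eq_tOf_zero_add hc ℓ
    simp only [classSet, Finset.mem_filter, Finset.mem_range]
    refine ⟨by omega, ?_⟩
    refine (Nat.modEq_iff_dvd.2 ?_ : Nat.ModEq p _ x)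
    rw [Int.toNat_of_nonneg (by linarith)]
    obtain ⟨c, hcx⟩ := hx
    exact ⟨c - ℓ, by rw [mul_sub, ← hcx, e]; ring⟩
  · -- injective
    intro ℓ₁ h₁ ℓ₂ h₂ heq
    obtain ⟨-, hN₁⟩ := Finset.mem_filter.1 h₁
    obtain ⟨-, hN₂⟩ := Finset.mem_filter.1 h₂
    obtain ⟨h11, -⟩ := (tOf_mem_num_iff hc).2 hN₁
    obtain ⟨h21, -⟩ := (tOf_mem_num_iff hc).2 hN₂
    have heq' : tOf (p : ℤ) m (b 0) ℓ₁ u = tOf (p : ℤ) m (b 0) ℓ₂ u := by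
      have := congrArg (fun n : ℕ => (n : ℤ)) heq
      simp only [Int.toNat_of_nonneg (show (0:ℤ) ≤ tOf (p : ℤ) m (b 0) ℓ₁ u - 1 by linarith),
        Int.toNat_of_nonneg (show (0:ℤ) ≤ tOf (p : ℤ) m (b 0) ℓ₂ u - 1 by linarith)] at this
      linarith
    exact (tOf_inj hp1 hc hc hu1 hu2 hu1 hu2 heq').1
  · -- surjective
    intro s hs
    simp only [classSet, Finset.mem_filter, Finset.mem_range] at hs
    obtain ⟨hs1, hs2⟩ := hs
    have hdvd : (p : ℤ) ∣ (x : ℤ) - s := Nat.modEq_iff_dvd.1 (hs2 : Nat.ModEq p s x)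
    have hdvd' : (p : ℤ) ∣ ((s : ℤ) + 1) - tOf (p : ℤ) m (b 0) 0 u := by
      have := dvd_sub hx hdvd
      have e : (x : ℤ) + 1 - tOf (p : ℤ) m (b 0) 0 u - ((x : ℤ) - s) = (s : ℤ) + 1 - tOf (p : ℤ) m (b 0) 0 u := by ring
      rwa [e] at this
    obtain ⟨ℓ, hℓ⟩ := exists_level_of_dvd hc hdvd'
    have hN : NumCov (p : ℤ) m (R0b p m (b 0)) ℓ u := (tOf_mem_num_iff hc).1 ⟨by omega, by omega⟩
    refine ⟨ℓ, Finset.mem_filter.2 ⟨mem_levels_of_numCov h hm hu1' hu2 hN, hN⟩, ?_⟩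
    rw [hℓ]
    omega

/-- **THE CLASS SUM** — Σ over the tree's residue class of `netExp` = the level sum of Part II:
`Σ_{q ∈ classSet b p x} netExp b q = [(u=0 ∧ m even) ∨ (u=p ∧ m odd)] − (4m + 8 − δ_A(u))`, `u` the class offset of `x`
(re-index by `sum_classSet_eq_sum_levels`, rewrite each term by `netExp_eq`, extend to all levels, then `sum_ord`). -/
theorem sum_classSet_netExp (h : LevelBox (p : ℤ) (R0b p m (b 0)) (rhob p m (b 0) (lowerB b))) (hm : 1 ≤ m)
    (hc : (u - R0b (p : ℤ) m (b 0)) % 2 = 0) (hu1 : -(p : ℤ) < u) (hu2 : u ≤ p) {x : ℕ}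
    (hx : (p : ℤ) ∣ (x : ℤ) + 1 - tOf p m (b 0) 0 u) :
    (∑ s ∈ classSet b p x, netExp b s) =
      indic ((u = 0 ∧ m % 2 = 0) ∨ (u = p ∧ m % 2 = 1))
        - (4 * m + 8 - deltaA (p : ℤ) (R0b p m (b 0)) (rhob p m (b 0) (lowerB b)) u) := by
  have hp1 : (1 : ℤ) ≤ p := h.one_le_p
  have hu1' : -(p : ℤ) ≤ u := by linarith
  rw [sum_classSet_eq_sum_levels h hm hc hu1 hu2 hx (netExp b)]
  -- step 1: term by term, `netExp = [d = 0] − ord` on the numerator levels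
  have step1 : (∑ ℓ ∈ (levels m).filter (fun ℓ => NumCov (p : ℤ) m (R0b p m (b 0)) ℓ u),
        netExp b (tOf (p : ℤ) m (b 0) ℓ u - 1).toNat) =
      ∑ ℓ ∈ (levels m).filter (fun ℓ => NumCov (p : ℤ) m (R0b p m (b 0)) ℓ u),
        (indic (dpos (p : ℤ) m ℓ u = 0) - ord (p : ℤ) (R0b p m (b 0)) m (rhob p m (b 0) (lowerB b)) ℓ u) := by
    refine Finset.sum_congr rfl (fun ℓ hℓ => ?_)
    obtain ⟨-, hN⟩ := Finset.mem_filter.1 hℓ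
    obtain ⟨h1, h2⟩ := (tOf_mem_num_iff hc).2 hN
    have hq : (((tOf (p : ℤ) m (b 0) ℓ u - 1).toNat : ℕ) : ℤ) + 1 = tOf (p : ℤ) m (b 0) ℓ u := by
      rw [Int.toNat_of_nonneg (by linarith)]; ring
    exact netExp_eq h hm hc hq (by rw [Int.toNat_of_nonneg (by linarith)]; linarith)
  -- step 2: extend to all levels (off the numerator both summands vanish)
  have step2 : (∑ ℓ ∈ (levels m).filter (fun ℓ => NumCov (p : ℤ) m (R0b p m (b 0)) ℓ u),
        (indic (dpos (p : ℤ) m ℓ u = 0) - ord (p : ℤ) (R0b p m (b 0)) m (rhob p m (b 0) (lowerB b)) ℓ u)) =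
      ∑ ℓ ∈ levels m,
        (indic (dpos (p : ℤ) m ℓ u = 0) - ord (p : ℤ) (R0b p m (b 0)) m (rhob p m (b 0) (lowerB b)) ℓ u) := by
    refine Finset.sum_filter_of_ne (fun ℓ _ hne => ?_)
    by_contra hN
    apply hne
    rw [ord_eq_zero_of_not_numCov h hm hN, indic_neg (fun hd => hN ?_)]
    · ring
    · unfold NumCov; rw [hd, abs_zero]
      have : 0 ≤ (3 * m - 2) * (p : ℤ) := mul_nonneg (by linarith) (by linarith)
      linarith [h.R0_nonneg]
  rw [step1, step2, Finset.sum_sub_distrib, sum_indic_dpos_eq_zero hp1 hm hu1 hu2, sum_ord h hm hu1' hu2]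

/-- **THE ODD CENTRE**: `CentreIn b p x ⟺ p ∣ 2x − b₀ ⟺ u ∈ {0, p}` (`2x − b₀ ≡ d(0,u) ≡ −u (mod p)`). -/
theorem centreIn_iff (h : LevelBox (p : ℤ) (R0b p m (b 0)) (rhob p m (b 0) (lowerB b)))
    (hc : (u - R0b (p : ℤ) m (b 0)) % 2 = 0) (hu1 : -(p : ℤ) < u) (hu2 : u ≤ p) {x : ℕ}
    (hx : (p : ℤ) ∣ (x : ℤ) + 1 - tOf p m (b 0) 0 u) :
    CentreIn b p x ↔ (u = 0 ∨ u = p) := by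
  have hp1 : (1 : ℤ) ≤ p := h.one_le_p
  unfold CentreIn
  have h2 := two_mul_tOf hc 0
  have e : 2 * (x : ℤ) - b 0 = 2 * ((x : ℤ) + 1 - tOf (p : ℤ) m (b 0) 0 u) + (p : ℤ) * (2 - 3 * m) - u := by
    unfold dpos at h2; linarith
  have h3 : (p : ℤ) ∣ 2 * ((x : ℤ) + 1 - tOf (p : ℤ) m (b 0) 0 u) + (p : ℤ) * (2 - 3 * m) :=
    dvd_add (dvd_mul_of_dvd_right hx 2) (dvd_mul_right _ _)
  rw [e]
  constructor
  · intro hd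
    have hu : (p : ℤ) ∣ u := by
      have := dvd_sub h3 hd
      rwa [sub_sub_cancel] at this
    obtain ⟨k, hk⟩ := hu
    rcases lt_trichotomy k 0 with hk0 | hk0 | hk0
    · have : (p : ℤ) * k ≤ -p := by nlinarith
      exfalso; linarith
    · left; rw [hk, hk0, mul_zero]
    · by_cases hk1 : k = 1
      · right; rw [hk, hk1, mul_one]
      · have hk2 : (2 : ℤ) ≤ k := by omega
        have : 2 * (p : ℤ) ≤ p * k := by nlinarith
        exfalso; linarith
  · intro hu
    have hu' : (p : ℤ) ∣ u := by
      rcases hu with h0 | h0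
      · rw [h0]; exact dvd_zero _
      · rw [h0]
    exact dvd_sub h3 hu'

/-- **PARITY OF `b₀`** (`p` odd): `b₀` is odd iff `u + m` is odd (`b₀ = R₀ + (3m−2)p`, `u ≡ R₀ (mod 2)`). -/
theorem b0_odd_iff (hp2 : (p : ℤ) % 2 = 1) (hc : (u - R0b (p : ℤ) m (b 0)) % 2 = 0) :
    ¬ (2 : ℤ) ∣ b 0 ↔ (u + m) % 2 = 1 := by
  unfold R0b at hc
  have hA : (3 * m - 2) * (p : ℤ) % 2 = (3 * m - 2) % 2 := by
    rw [Int.mul_emod, hp2, mul_one, Int.emod_emod_of_dvd _ (dvd_refl 2)]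
  rw [Int.two_dvd_ne_zero]
  generalize (3 * m - 2) * (p : ℤ) = A at hc hA
  omega

/-- **MAIN IDENTITY — the tree's class exponent IS the threshold score**: for a tree cell in the level box at `(m, p)`,
`p` odd, and a residue `x` of class offset `u`:
    `E_x = classExp b p x = scoreA(u) − (4m + 8) = δ_A(u) + [u ∈ {0,p}] − (4m + 8)`
(S3a + both centre conventions: the merged even centre and the odd-centre unit of `classExp` add up to `[u ∈ {0,p}]`). -/
theorem classExp_eq (h : LevelBox (p : ℤ) (R0b p m (b 0)) (rhob p m (b 0) (lowerB b))) (hm : 1 ≤ m)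
    (hp2 : (p : ℤ) % 2 = 1) (hc : (u - R0b (p : ℤ) m (b 0)) % 2 = 0) (hu1 : -(p : ℤ) < u) (hu2 : u ≤ p) {x : ℕ}
    (hx : (p : ℤ) ∣ (x : ℤ) + 1 - tOf p m (b 0) 0 u) :
    classExp b p x = scoreA (p : ℤ) (R0b p m (b 0)) (rhob p m (b 0) (lowerB b)) u - (4 * m + 8) := by
  have hp1 : (1 : ℤ) ≤ p := h.one_le_p
  have hpar := b0_odd_iff (b := b) (m := m) hp2 hc
  have hcen := centreIn_iff h hc hu1 hu2 hx
  unfold classExp scoreA centre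
  rw [sum_classSet_netExp h hm hc hu1 hu2 hx]
  simp only [hpar, hcen]
  unfold indic
  split_ifs <;> omega

/-- the same, for EVERY residue `x`, with the explicit class offset `uOf`. -/
theorem classExp_eq_uOf (h : LevelBox (p : ℤ) (R0b p m (b 0)) (rhob p m (b 0) (lowerB b))) (hm : 1 ≤ m)
    (hp2 : (p : ℤ) % 2 = 1) (x : ℕ) :
    classExp b p x = scoreA (p : ℤ) (R0b p m (b 0)) (rhob p m (b 0) (lowerB b)) (uOf p m (b 0) x) - (4 * m + 8) := by
  obtain ⟨h1, h2, hc, -⟩ := uOf_spec (m := m) (b0 := b 0) h.one_le_p (x : ℤ)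
  exact classExp_eq h hm hp2 hc h1 h2 (dvd_uOf h.one_le_p (x : ℤ))

/-- **COROLLARY**: on a DEEP tree cell some residue has `E_x ≤ 4 − (4m + 8)` (Part I's explicit class `u*` with
`score(u*) ≤ 4`, read through `classExp_eq`); with `isDominant_iff_classExp_le` the dominant classes sit at the minimum. -/
theorem classExp_min_le_of_deep (hB : BCell (p : ℤ) ((m - 1) * p) (b 0) (lowerB b)) (hm : 1 ≤ m) :
    ∃ x : ℕ, classExp b p x ≤ 4 - (4 * m + 8) := by
  have hD : DeepCell (p : ℤ) (R0b p m (b 0)) (rhob p m (b 0) (lowerB b)) := by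
    rw [rhob_eq_rhoOf, R0b_eq_R0Of]; exact hB.deepCell
  have h := hD.levelBox
  have hp1 : (1 : ℤ) ≤ p := h.one_le_p
  set us := utStar (p : ℤ) (R0b p m (b 0)) (rhob p m (b 0) (lowerB b)) with hus
  have hcs := hD.utStar_isClass
  obtain ⟨x, hx⟩ := exists_residue (m := m) (b0 := b 0) hp1 us
  refine ⟨x, ?_⟩
  rw [classExp_eq h hm hB.odd_p hcs.2.2 hcs.1 hcs.2.1 hx]
  have h4 := hD.score_utStar_le_four
  have hle : scoreA (p : ℤ) (R0b p m (b 0)) (rhob p m (b 0) (lowerB b)) us ≤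
      score (p : ℤ) (R0b p m (b 0)) (rhob p m (b 0) (lowerB b)) us := by
    unfold scoreA score; linarith [DeepCell.deltaA_le_delta (p : ℤ) (R0b p m (b 0)) (rhob p m (b 0) (lowerB b)) us]
  linarith

/-- **DOMINANCE = MINIMAL CLASS EXPONENT**: on a deep tree cell (Part I's `BCell` at `q = (m−1)p`), a class `u` is
DOMINANT (argmin of the threshold score — Part I; both notions, `isDominant_iff_isDominantA`) iff its residue `x` has the
least `E_x` among ALL residues `x'` — the valuation-theoretic meaning of dominance, stated on the tree's `classExp`. -/
theorem isDominant_iff_classExp_le (hB : BCell (p : ℤ) ((m - 1) * p) (b 0) (lowerB b)) (hm : 1 ≤ m)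
    (hcl : IsClass (p : ℤ) (R0b p m (b 0)) u) {x : ℕ} (hx : (p : ℤ) ∣ (x : ℤ) + 1 - tOf p m (b 0) 0 u) :
    IsDominant (p : ℤ) (R0b p m (b 0)) (rhob p m (b 0) (lowerB b)) u ↔ ∀ x' : ℕ, classExp b p x ≤ classExp b p x' := by
  have hD : DeepCell (p : ℤ) (R0b p m (b 0)) (rhob p m (b 0) (lowerB b)) := by
    rw [rhob_eq_rhoOf, R0b_eq_R0Of]; exact hB.deepCell
  have h := hD.levelBox
  have hp1 : (1 : ℤ) ≤ p := h.one_le_p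
  have hp2 : (p : ℤ) % 2 = 1 := hB.odd_p
  rw [hD.isDominant_iff_isDominantA]
  unfold IsDominantA
  rw [classExp_eq h hm hp2 hcl.2.2 hcl.1 hcl.2.1 hx]
  constructor
  · rintro ⟨-, hmin⟩ x'
    rw [classExp_eq_uOf h hm hp2 x']
    linarith [hmin _ (uOf_isClass (m := m) (b0 := b 0) hp1 (x' : ℤ))]
  · intro hmin
    refine ⟨hcl, fun u' hu' => ?_⟩
    obtain ⟨x', hx'⟩ := exists_residue (m := m) (b0 := b 0) hp1 u'
    have := hmin x'
    rw [classExp_eq h hm hp2 hu'.2.2 hu'.1 hu'.2.1 hx'] at this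
    linarith

/-! ### The poles of a class: `classPoleCount` on the level side; a dominant class has exactly `m + 1` poles -/

/-- **THE POLE COUNT ON THE LEVEL SIDE**: the number of poles of the tree's class of `x` (positions with `netExp < 0`)
is the number of levels `ℓ ∈ [−1, 3m−1]` of its class offset `u` with `ord(ℓ,u) > [d(ℓ,u) = 0]`. -/
theorem classPoleCount_eq (h : LevelBox (p : ℤ) (R0b p m (b 0)) (rhob p m (b 0) (lowerB b))) (hm : 1 ≤ m)
    (hc : (u - R0b (p : ℤ) m (b 0)) % 2 = 0) (hu1 : -(p : ℤ) < u) (hu2 : u ≤ p) {x : ℕ}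
    (hx : (p : ℤ) ∣ (x : ℤ) + 1 - tOf p m (b 0) 0 u) :
    (classPoleCount b p x : ℤ) =
      ∑ ℓ ∈ levels m, indic (indic (dpos (p : ℤ) m ℓ u = 0) < ord (p : ℤ) (R0b p m (b 0)) m (rhob p m (b 0) (lowerB b)) ℓ u) := by
  have hp1 : (1 : ℤ) ≤ p := h.one_le_p
  unfold classPoleCount
  rw [Finset.card_filter]
  push_cast
  rw [sum_classSet_eq_sum_levels h hm hc hu1 hu2 hx (fun s => if netExp b s < 0 then (1 : ℤ) else 0)]
  -- term by term on the numerator levels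
  have step1 : (∑ ℓ ∈ (levels m).filter (fun ℓ => NumCov (p : ℤ) m (R0b p m (b 0)) ℓ u),
        (fun s => if netExp b s < 0 then (1 : ℤ) else 0) (tOf (p : ℤ) m (b 0) ℓ u - 1).toNat) =
      ∑ ℓ ∈ (levels m).filter (fun ℓ => NumCov (p : ℤ) m (R0b p m (b 0)) ℓ u),
        indic (indic (dpos (p : ℤ) m ℓ u = 0) < ord (p : ℤ) (R0b p m (b 0)) m (rhob p m (b 0) (lowerB b)) ℓ u) := by
    refine Finset.sum_congr rfl (fun ℓ hℓ => ?_)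
    obtain ⟨-, hN⟩ := Finset.mem_filter.1 hℓ
    obtain ⟨h1, h2⟩ := (tOf_mem_num_iff hc).2 hN
    have hq : (((tOf (p : ℤ) m (b 0) ℓ u - 1).toNat : ℕ) : ℤ) + 1 = tOf (p : ℤ) m (b 0) ℓ u := by
      rw [Int.toNat_of_nonneg (by linarith)]; ring
    have e := netExp_eq h hm hc hq (by rw [Int.toNat_of_nonneg (by linarith)]; linarith)
    show (if netExp b (tOf (p : ℤ) m (b 0) ℓ u - 1).toNat < 0 then (1 : ℤ) else 0) = _
    rw [e]
    exact indic_congr ⟨fun h0 => by linarith, fun h0 => by linarith⟩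
  -- off the numerator: no pole
  have step2 : (∑ ℓ ∈ (levels m).filter (fun ℓ => NumCov (p : ℤ) m (R0b p m (b 0)) ℓ u),
        indic (indic (dpos (p : ℤ) m ℓ u = 0) < ord (p : ℤ) (R0b p m (b 0)) m (rhob p m (b 0) (lowerB b)) ℓ u)) =
      ∑ ℓ ∈ levels m,
        indic (indic (dpos (p : ℤ) m ℓ u = 0) < ord (p : ℤ) (R0b p m (b 0)) m (rhob p m (b 0) (lowerB b)) ℓ u) := by
    refine Finset.sum_filter_of_ne (fun ℓ _ hne => ?_)
    by_contra hN
    apply hne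
    rw [ord_eq_zero_of_not_numCov h hm hN]
    exact indic_neg (fun hlt => by linarith [indic_nonneg (dpos (p : ℤ) m ℓ u = 0)])
  rw [step1, step2]

/-- per level, for a DOMINANT class of a deep cell: the poles are exactly the pole-frame levels `m−1 ≤ ℓ ≤ 2m−1`
(orders `6 − L`, `6`, …, `6`, `6 − R`, all `≥ 2 > [d = 0]` since `δ ≤ 4`; the zero frame and the levels `−1`, `3m−1` carry
`ord ≤ 0`). -/
theorem DeepCell.pole_indic_of_dominant {p R0 : ℤ} {r : Fin 7 → ℤ} (hD : DeepCell p R0 r) {u : ℤ}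
    (hd : IsDominant p R0 r u) {m : ℤ} (hm : 1 ≤ m) {ℓ : ℤ} (hℓ : ℓ ∈ levels m) :
    indic (indic (dpos p m ℓ u = 0) < ord p R0 m r ℓ u) = (if m - 1 ≤ ℓ ∧ ℓ ≤ 2 * m - 1 then 1 else 0) := by
  have hE := hD.dominant_excess_eq hd hm ℓ
  have hδ := hD.dominant_delta_le_four hd
  have hL0 := countLt_nonneg r (u + p)
  have hR0 := countLt_nonneg r (p - u)
  have hnp0 := indic_nonneg (2 * p - R0 ≤ u)
  have hnm0 := indic_nonneg (u ≤ R0 - 2 * p)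
  have hc0 := indic_nonneg (dpos p m ℓ u = 0)
  have hc1 := indic_le_one (dpos p m ℓ u = 0)
  unfold delta L R np nm at hδ
  unfold excess L R np nm at hE
  unfold levels at hℓ
  rw [Finset.mem_Ico] at hℓ
  -- the region of ℓ
  by_cases hpole : m - 1 ≤ ℓ ∧ ℓ ≤ 2 * m - 1
  · rw [if_pos hpole, Tsym_pole hpole.1 hpole.2] at *
    refine indic_pos ?_
    by_cases c1 : ℓ = m - 1
    · rw [if_pos c1] at hE; linarith
    · rw [if_neg c1] at hE
      by_cases c2 : ℓ = 2 * m - 1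
      · rw [if_pos c2] at hE; linarith
      · rw [if_neg c2, if_neg (by omega), if_neg (by omega)] at hE; linarith
  · rw [if_neg hpole]
    refine indic_neg ?_
    rw [if_neg (by omega), if_neg (by omega)] at hE
    rcases (show ℓ = -1 ∨ (0 ≤ ℓ ∧ ℓ ≤ m - 2) ∨ (2 * m ≤ ℓ ∧ ℓ ≤ 3 * m - 2) ∨ ℓ = 3 * m - 1 by omega) with e | ⟨e1, e2⟩ | ⟨e1, e2⟩ | e
    · rw [Tsym_outside hm (Or.inl (by omega)), if_neg (by omega), if_pos e] at hE; linarith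
    · rw [Tsym_zeroLo e1 e2, if_neg (by omega), if_neg (by omega)] at hE; linarith
    · rw [Tsym_zeroHi e1 e2, if_neg (by omega), if_neg (by omega)] at hE; linarith
    · rw [Tsym_outside hm (Or.inr (by omega)), if_pos e] at hE; linarith

/-- `Σ_{ℓ ∈ [−1, 3m)} [m−1 ≤ ℓ ≤ 2m−1] = m + 1` (the pole frame has `m + 1` levels). -/
theorem sum_pole_frame (hm : (1 : ℤ) ≤ m) :
    (∑ ℓ ∈ levels m, (if m - 1 ≤ ℓ ∧ ℓ ≤ 2 * m - 1 then (1 : ℤ) else 0)) = m + 1 := by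
  unfold levels
  rw [sum_Ico_split _ (show (-1 : ℤ) ≤ m - 1 by omega) (by omega),
    sum_Ico_split _ (show m - 1 ≤ 2 * m by omega) (by omega),
    sum_Ico_const_of _ 0 (by omega) (fun x h0 h1 => if_neg (by omega)),
    sum_Ico_const_of _ 1 (by omega) (fun x h0 h1 => if_pos (by omega)),
    sum_Ico_const_of _ 0 (by omega) (fun x h0 h1 => if_neg (by omega))]
  ring

/-- **A DOMINANT CLASS OF A DEEP CELL HAS EXACTLY `m + 1` POLES** — the pole-frame levels, each of order `≥ 2` up to the
merged centre: so on the D region the tree's single-pole regime (Theorem A′, `ZeroEvaluation`) never meets a dominant class,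
and the two-pole regime of Theorems B/C (`2 ≤ classPoleCount`) always does. -/
theorem classPoleCount_of_dominant (hB : BCell (p : ℤ) ((m - 1) * p) (b 0) (lowerB b)) (hm : 1 ≤ m)
    (hd : IsDominant (p : ℤ) (R0b p m (b 0)) (rhob p m (b 0) (lowerB b)) u) {x : ℕ}
    (hx : (p : ℤ) ∣ (x : ℤ) + 1 - tOf p m (b 0) 0 u) :
    (classPoleCount b p x : ℤ) = m + 1 := by
  have hD : DeepCell (p : ℤ) (R0b p m (b 0)) (rhob p m (b 0) (lowerB b)) := by
    rw [rhob_eq_rhoOf, R0b_eq_R0Of]; exact hB.deepCell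
  have h := hD.levelBox
  rw [classPoleCount_eq h hm hd.1.2.2 hd.1.1 hd.1.2.1 hx,
    Finset.sum_congr rfl (fun ℓ hℓ => hD.pole_indic_of_dominant hd hm hℓ), sum_pole_frame hm]

end ClassExp

/-! ### The octave shift law for `E_x` -/

end TreeBridge

end Summit.KontsevichZagierPeriods.Zeta5Search.DenomLaw.ThresholdModel.Rho
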